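import Summits.CriticalPhenomena.PercolationContinuityZ3.Theorems.Transplant.FKConnectivityAllQK5DisjMasks
import Mathlib.Tactic.FieldSimp
import HarnessLib

/-!
# `K₅` is Potts–Rayleigh (`0 < q ≤ 1`), disjoint pairs — file 3: semantics of the block check, positive semidefiniteness

Helper file (`--supports stmt-CriticalPhenomena-4575`), FK sub-lane `prim-bschramm-fk-3` (gen 11) of the post-continuity programme;
builds on p205010 (kernel theorem, internal audit signed; external expert review pending).  No named facts, no sorries; standard axioms.

THE THEOREM OF THIS CHAIN (`…K5Disj`): **`K₅` is Potts–Rayleigh for every `0 < q ≤ 1`** — the random-cluster measure `φ_{w,q}` on every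
weighted graph with at most five vertices is edge-negatively associated, `φ(J_e ∩ J_f) ≤ φ(J_e)φ(J_f)` for ALL pairs `e ≠ f` (adjacent pairs:
gen 10, `…K5`; this chain: the disjoint pairs, one `S₅`-orbit, `(e, f) = (01, 23)`).  Wagner 2008, Ex. 5.2 records Sokal's computation for
`K₄`; for `K₅` the Rayleigh difference `Z¹⁰Z⁰¹ − Z⁰⁰Z¹¹` of `(01, 23)` has negative coefficients that no binomial (AM–GM) square repairs
(gen 10, LP scoping), so the certificate is a SUM OF GRAM SQUARES: with `y` the odds parameters of the eight pairs `E₈' = K₅ − {01, 23}`,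
the reduced difference `D̂ = (Z¹⁰Z⁰¹ − Z⁰⁰Z¹¹)/(q²(1−q))` (degree `4` in `q`) is written in the scaled Bernstein basis
`Σ_{j ≤ 4} B̃_j(y) q^j (1−q)^{4−j}`, and each slice `B̃_j` is certified `≥ 0` on the orthant as
`B̃_j = Σ_T y^T · m_Tᵀ H_{T,j} m_T + (nonnegative coefficients)`, `|T| ≤ 2`, `m_T` the multi-affine monomials off `T` inside the
Newton polytope, `H_{T,j} = U K Uᵀ` integer positive semidefinite (witness `s²K = LLᵀ + E`, `E` diagonally dominant).  The certificates
were found by semidefinite programming, facial reduction and integer rounding OUTSIDE Lean (bschramm/FK-BARRIER.md §15) and are CHECKED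
HERE BY THE KERNEL (`decide +kernel`), fiber by fiber (`3^8 = 6561` fibers per slice).
[cite: Wagner2006, Ex. 5.2, Conj. 5.3, Thm. 5.8 (p. 13)] [cite: Grimmett2006, §3.9 eq. (3.94), Conj. (3.96) (pp. 63–66); §1.4 eq. (1.20) (p. 15)]

THIS FILE: what `K5D.blockOK c = true` says (`blockOK_sound`), and the real algebra behind the PSD witness: a symmetric row-diagonally
dominant matrix has a nonnegative quadratic form (`quadForm_nonneg_of_dd`), a Gram form `Σ_t (Σ_a L_{at} w_a)²` is nonnegative, the
change of variables `w = Uᵀz`, hence **`block_quadForm_nonneg`**: `Σ_{a,b} H[a][b] z_a z_b ≥ 0` for every well-formed block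
(`H = U K Uᵀ`, `s²K = LLᵀ + E`).
-/

namespace Summit.CriticalPhenomena.PercolationContinuityZ3.Theorems

namespace FK

namespace K5D

open Finset

/-- `zsum n f = Σ_{i<n} f i`. [folklore] -/
theorem zsum_eq (n : ℕ) (f : ℕ → ℤ) : zsum n f = ∑ i ∈ range n, f i := by
  unfold zsum
  suffices h : ∀ (init : ℤ), (List.range n).foldl (fun s i => s + f i) init = init + ∑ i ∈ range n, f i by
    simpa using h 0
  induction n with
  | zero => intro init; simp
  | succ n ih =>
    intro init
    rw [List.range_succ, List.foldl_append, ih, Finset.sum_range_succ]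
    simp [add_assoc]

/-- bit fields are bounded -/
theorem fld_lt (c off w : ℕ) : fld c off w < 2 ^ w := by
  unfold fld
  rw [Nat.and_two_pow_sub_one_eq_mod]
  exact Nat.mod_lt _ (by positivity)

/-- basis masks are `< 256`. [folklore] -/
theorem bas_lt (c a : ℕ) : bas c a < 256 := fld_lt c _ 8
/-- the `T` mask is `< 256`. [folklore] -/
theorem hT_lt (c : ℕ) : hT c < 256 := fld_lt c 0 8

/-- the facts recorded by `blockOK` -/
theorem blockOK_sound {c : ℕ} (h : blockOK c = true) :
    0 < hn c ∧ 0 < hr c ∧ 0 < hs c ∧ (hU c = true ∨ hn c = hr c) ∧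
    (∀ a < hn c, bas c a &&& hT c = 0) ∧
    (∀ a < hr c, ∀ b < hr c, eK c a b = eK c b a) ∧
    (∀ a < hn c, ∀ b < hn c, eH c a b = eUKU c a b) ∧
    (∀ a < hr c, (∑ b ∈ range (hr c), if a = b then 0 else |eE c a b|) ≤ eE c a a) := by
  unfold blockOK at h
  simp only [Bool.and_eq_true, decide_eq_true_eq, Bool.or_eq_true, beq_iff_eq, List.all_eq_true, List.mem_range] at h
  obtain ⟨⟨⟨⟨⟨⟨⟨h1, h2⟩, h3⟩, h4⟩, h5⟩, h6⟩, h7⟩, h8⟩ := h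
  refine ⟨h1, h2, h3, h4, h5, h6, h7, fun a ha => ?_⟩
  have h8a := h8 a ha
  rw [zsum_eq] at h8a
  have hre : ∀ b, (bif a == b then (0 : ℤ) else zabs (eE c a b)) = if a = b then 0 else |eE c a b| := by
    intro b
    by_cases hab : a = b
    · simp [hab]
    · have : (a == b) = false := beq_false_of_ne hab
      rw [this, if_neg hab]
      unfold zabs
      by_cases hneg : eE c a b < 0
      · simp [hneg, abs_of_neg hneg]
      · simp [hneg, abs_of_nonneg (not_lt.1 hneg)]
  simp only [hre] at h8a
  exact h8a

/-! ### Real algebra: a symmetric row-diagonally-dominant matrix is positive semidefinite -/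

/-- a symmetric row-diagonally-dominant matrix has a nonnegative quadratic form. [folklore] -/
theorem quadForm_nonneg_of_dd (r : ℕ) (E : ℕ → ℕ → ℝ) (w : ℕ → ℝ)
    (hsym : ∀ a < r, ∀ b < r, E a b = E b a)
    (hdd : ∀ a < r, (∑ b ∈ range r, if a = b then 0 else |E a b|) ≤ E a a) :
    0 ≤ ∑ a ∈ range r, ∑ b ∈ range r, E a b * (w a * w b) := by
  -- split the diagonal
  have hsplit : ∀ a ∈ range r, ∑ b ∈ range r, E a b * (w a * w b) =
      E a a * (w a * w a) + ∑ b ∈ range r, (if a = b then 0 else E a b * (w a * w b)) := by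
    intro a ha
    rw [← Finset.sum_erase_add _ _ ha]
    have : ∑ b ∈ (range r).erase a, E a b * (w a * w b) = ∑ b ∈ range r, if a = b then 0 else E a b * (w a * w b) := by
      rw [← Finset.sum_erase_add (range r) _ ha, if_pos rfl, add_zero]
      exact Finset.sum_congr rfl fun b hb => by rw [if_neg (Finset.ne_of_mem_erase hb).symm]
    rw [this, add_comm]
  rw [Finset.sum_congr rfl hsplit, Finset.sum_add_distrib]
  -- bound the off-diagonal part: E a b w_a w_b ≥ -|E a b| (w_a² + w_b²)/2
  have hoff : ∀ a ∈ range r, ∀ b ∈ range r,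
      -(if a = b then 0 else |E a b| * ((w a * w a + w b * w b) / 2)) ≤ (if a = b then 0 else E a b * (w a * w b)) := by
    intro a _ b _
    split_ifs
    · simp
    · have h1 : -(|E a b| * |w a * w b|) ≤ E a b * (w a * w b) := by
        rw [← abs_mul]; exact neg_abs_le _
      have h2 : |w a * w b| ≤ (w a * w a + w b * w b) / 2 := by
        rw [abs_le]; constructor <;> nlinarith [sq_nonneg (w a - w b), sq_nonneg (w a + w b)]
      nlinarith [abs_nonneg (E a b)]
  have hoffsum : -(∑ a ∈ range r, ∑ b ∈ range r, if a = b then 0 else |E a b| * ((w a * w a + w b * w b) / 2)) ≤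
      ∑ a ∈ range r, ∑ b ∈ range r, (if a = b then 0 else E a b * (w a * w b)) := by
    rw [← Finset.sum_neg_distrib]
    refine Finset.sum_le_sum fun a ha => ?_
    rw [← Finset.sum_neg_distrib]
    exact Finset.sum_le_sum fun b hb => hoff a ha b hb
  -- symmetrise the bound: Σ_{a≠b} |E a b| (w_a² + w_b²)/2 = Σ_{a≠b} |E a b| w_a²
  have hsymm : ∑ a ∈ range r, ∑ b ∈ range r, (if a = b then 0 else |E a b| * ((w a * w a + w b * w b) / 2)) =
      ∑ a ∈ range r, (∑ b ∈ range r, if a = b then 0 else |E a b|) * (w a * w a) := by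
    have hhalf : ∀ a ∈ range r, ∀ b ∈ range r, (if a = b then 0 else |E a b| * ((w a * w a + w b * w b) / 2)) =
        (if a = b then 0 else |E a b| * (w a * w a) / 2) + (if a = b then 0 else |E a b| * (w b * w b) / 2) := by
      intro a _ b _; split_ifs <;> ring
    rw [Finset.sum_congr rfl fun a ha => Finset.sum_congr rfl fun b hb => hhalf a ha b hb]
    simp only [Finset.sum_add_distrib]
    rw [Finset.sum_comm (f := fun a b => if a = b then (0:ℝ) else |E a b| * (w b * w b) / 2)]
    have hswap : ∀ b ∈ range r, ∀ a ∈ range r, (if a = b then 0 else |E a b| * (w b * w b) / 2) =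
        (if b = a then 0 else |E b a| * (w b * w b) / 2) := by
      intro b hb a ha
      by_cases hab : a = b
      · subst hab; simp
      · rw [if_neg hab, if_neg (Ne.symm hab), hsym a (mem_range.1 ha) b (mem_range.1 hb)]
    rw [Finset.sum_congr rfl fun b hb => Finset.sum_congr rfl fun a ha => hswap b hb a ha, ← Finset.sum_add_distrib]
    refine Finset.sum_congr rfl fun a _ => ?_
    rw [← Finset.sum_add_distrib, Finset.sum_mul]
    refine Finset.sum_congr rfl fun b _ => ?_
    split_ifs <;> ring
  rw [hsymm] at hoffsum
  have hdiag : ∑ a ∈ range r, (∑ b ∈ range r, if a = b then 0 else |E a b|) * (w a * w a) ≤ ∑ a ∈ range r, E a a * (w a * w a) :=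
    Finset.sum_le_sum fun a ha => mul_le_mul_of_nonneg_right (hdd a (mem_range.1 ha)) (mul_self_nonneg _)
  linarith

/-- a Gram quadratic form `Σ_{a,b} (Σ_t L a t L b t) w_a w_b = Σ_t (Σ_a L a t w_a)²` is nonnegative -/
theorem quadForm_gram_nonneg (n r : ℕ) (L : ℕ → ℕ → ℝ) (w : ℕ → ℝ) :
    0 ≤ ∑ a ∈ range n, ∑ b ∈ range n, (∑ t ∈ range r, L a t * L b t) * (w a * w b) := by
  have h1 : ∑ a ∈ range n, ∑ b ∈ range n, (∑ t ∈ range r, L a t * L b t) * (w a * w b) =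
      ∑ a ∈ range n, ∑ b ∈ range n, ∑ t ∈ range r, L a t * w a * (L b t * w b) := by
    refine sum_congr rfl fun a _ => sum_congr rfl fun b _ => ?_
    rw [Finset.sum_mul]
    exact sum_congr rfl fun t _ => by ring
  have h2 : ∑ t ∈ range r, (∑ a ∈ range n, L a t * w a) * (∑ b ∈ range n, L b t * w b) =
      ∑ t ∈ range r, ∑ a ∈ range n, ∑ b ∈ range n, L a t * w a * (L b t * w b) := by
    refine sum_congr rfl fun t _ => ?_
    rw [Finset.sum_mul_sum]
  have h3 : ∑ a ∈ range n, ∑ b ∈ range n, ∑ t ∈ range r, L a t * w a * (L b t * w b) =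
      ∑ t ∈ range r, ∑ a ∈ range n, ∑ b ∈ range n, L a t * w a * (L b t * w b) := by
    calc ∑ a ∈ range n, ∑ b ∈ range n, ∑ t ∈ range r, L a t * w a * (L b t * w b)
        = ∑ a ∈ range n, ∑ t ∈ range r, ∑ b ∈ range n, L a t * w a * (L b t * w b) :=
          sum_congr rfl fun a _ => Finset.sum_comm
      _ = ∑ t ∈ range r, ∑ a ∈ range n, ∑ b ∈ range n, L a t * w a * (L b t * w b) := Finset.sum_comm
  rw [h1, h3, ← h2]
  exact Finset.sum_nonneg fun t _ => mul_self_nonneg _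

/-- change of variables in a quadratic form: `Σ_{a,b} (Σ_{k} (Σ_i U a i K i k) U b k) z_a z_b = Σ_{i,k} K i k w_i w_k`, `w = Uᵀ z` -/
theorem quadForm_congr_transform (n r : ℕ) (U : ℕ → ℕ → ℝ) (K : ℕ → ℕ → ℝ) (z : ℕ → ℝ) :
    ∑ a ∈ range n, ∑ b ∈ range n, (∑ k ∈ range r, (∑ i ∈ range r, U a i * K i k) * U b k) * (z a * z b) =
      ∑ i ∈ range r, ∑ k ∈ range r, K i k * ((∑ a ∈ range n, U a i * z a) * (∑ b ∈ range n, U b k * z b)) := by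
  have lhs : ∑ a ∈ range n, ∑ b ∈ range n, (∑ k ∈ range r, (∑ i ∈ range r, U a i * K i k) * U b k) * (z a * z b) =
      ∑ a ∈ range n, ∑ b ∈ range n, ∑ i ∈ range r, ∑ k ∈ range r, U a i * K i k * U b k * (z a * z b) := by
    refine sum_congr rfl fun a _ => sum_congr rfl fun b _ => ?_
    simp only [Finset.sum_mul]
    rw [Finset.sum_comm]
  have rhs : ∑ i ∈ range r, ∑ k ∈ range r, K i k * ((∑ a ∈ range n, U a i * z a) * (∑ b ∈ range n, U b k * z b)) =
      ∑ i ∈ range r, ∑ k ∈ range r, ∑ a ∈ range n, ∑ b ∈ range n, U a i * K i k * U b k * (z a * z b) := by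
    refine sum_congr rfl fun i _ => sum_congr rfl fun k _ => ?_
    rw [Finset.sum_mul_sum, Finset.mul_sum]
    refine sum_congr rfl fun a _ => ?_
    rw [Finset.mul_sum]
    refine sum_congr rfl fun b _ => ?_
    ring
  rw [lhs, rhs]
  -- reorder the four sums: (a, b, i, k) ↦ (i, k, a, b)
  calc ∑ a ∈ range n, ∑ b ∈ range n, ∑ i ∈ range r, ∑ k ∈ range r, U a i * K i k * U b k * (z a * z b)
      = ∑ a ∈ range n, ∑ i ∈ range r, ∑ b ∈ range n, ∑ k ∈ range r, U a i * K i k * U b k * (z a * z b) :=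
        sum_congr rfl fun a _ => Finset.sum_comm
    _ = ∑ i ∈ range r, ∑ a ∈ range n, ∑ b ∈ range n, ∑ k ∈ range r, U a i * K i k * U b k * (z a * z b) := Finset.sum_comm
    _ = ∑ i ∈ range r, ∑ a ∈ range n, ∑ k ∈ range r, ∑ b ∈ range n, U a i * K i k * U b k * (z a * z b) :=
        sum_congr rfl fun i _ => sum_congr rfl fun a _ => Finset.sum_comm
    _ = ∑ i ∈ range r, ∑ k ∈ range r, ∑ a ∈ range n, ∑ b ∈ range n, U a i * K i k * U b k * (z a * z b) :=
        sum_congr rfl fun i _ => Finset.sum_comm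

/-- **Block positivity**: for a well-formed block, the quadratic form of `H` is nonnegative. -/
theorem block_quadForm_nonneg {c : ℕ} (h : blockOK c = true) (z : ℕ → ℝ) :
    0 ≤ ∑ a ∈ range (hn c), ∑ b ∈ range (hn c), (eH c a b : ℝ) * (z a * z b) := by
  obtain ⟨_, _, hspos, _, _, hKsym, hH, hdd⟩ := blockOK_sound h
  set n := hn c
  set r := hr c
  -- H = U K Uᵀ
  have hHr : ∀ a ∈ range n, ∀ b ∈ range n, (eH c a b : ℝ) =
      ∑ k ∈ range r, (∑ i ∈ range r, (eU c a i : ℝ) * (eK c i k : ℝ)) * (eU c b k : ℝ) := by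
    intro a ha b hb
    rw [hH a (mem_range.1 ha) b (mem_range.1 hb)]
    unfold eUKU eUK
    rw [zsum_eq]
    push_cast
    refine Finset.sum_congr rfl fun k _ => ?_
    rw [zsum_eq]
    push_cast
    rfl
  rw [Finset.sum_congr rfl fun a ha => Finset.sum_congr rfl fun b hb => by rw [hHr a ha b hb]]
  rw [quadForm_congr_transform]
  set w : ℕ → ℝ := fun i => ∑ a ∈ range n, (eU c a i : ℝ) * z a
  -- s² K = L Lᵀ + E
  have hsR : (0 : ℝ) < (hs c : ℝ) := by exact_mod_cast hspos
  have hdecomp : ∀ i ∈ range r, ∀ k ∈ range r, (eK c i k : ℝ) =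
      ((∑ t ∈ range r, (eL c i t : ℝ) * (eL c k t : ℝ)) + (eE c i k : ℝ)) / ((hs c : ℝ) * (hs c : ℝ)) := by
    intro i _ k _
    unfold eE
    rw [zsum_eq]
    push_cast
    field_simp
    ring
  rw [Finset.sum_congr rfl fun i hi => Finset.sum_congr rfl fun k hk => by rw [hdecomp i hi k hk]]
  have hE_sym : ∀ a < r, ∀ b < r, (eE c a b : ℝ) = (eE c b a : ℝ) := by
    intro a ha b hb
    unfold eE
    rw [zsum_eq, zsum_eq, hKsym a ha b hb]
    push_cast
    congr 1
    exact Finset.sum_congr rfl fun t _ => mul_comm _ _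
  have hE_dd : ∀ a < r, (∑ b ∈ range r, if a = b then 0 else |(eE c a b : ℝ)|) ≤ (eE c a a : ℝ) := by
    intro a ha
    have := hdd a ha
    have hcast : ((∑ b ∈ range r, if a = b then (0 : ℤ) else |eE c a b| : ℤ) : ℝ) =
        ∑ b ∈ range r, if a = b then (0 : ℝ) else |(eE c a b : ℝ)| := by
      push_cast
      exact Finset.sum_congr rfl fun b _ => by split_ifs <;> simp
    rw [← hcast]
    exact_mod_cast this
  have h1 := quadForm_gram_nonneg r r (fun i t => (eL c i t : ℝ)) w
  have h2 := quadForm_nonneg_of_dd r (fun a b => (eE c a b : ℝ)) w hE_sym hE_dd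
  have hsum : ∑ i ∈ range r, ∑ k ∈ range r,
      ((∑ t ∈ range r, (eL c i t : ℝ) * (eL c k t : ℝ)) + (eE c i k : ℝ)) / ((hs c : ℝ) * (hs c : ℝ)) * (w i * w k) =
      ((∑ i ∈ range r, ∑ k ∈ range r, (∑ t ∈ range r, (eL c i t : ℝ) * (eL c k t : ℝ)) * (w i * w k)) +
        ∑ i ∈ range r, ∑ k ∈ range r, (eE c i k : ℝ) * (w i * w k)) / ((hs c : ℝ) * (hs c : ℝ)) := by
    rw [← Finset.sum_add_distrib, div_eq_mul_inv, Finset.sum_mul]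
    refine sum_congr rfl fun i _ => ?_
    rw [← Finset.sum_add_distrib, Finset.sum_mul]
    refine sum_congr rfl fun k _ => ?_
    ring
  rw [hsum]
  exact div_nonneg (add_nonneg h1 h2) (mul_pos hsR hsR).le

end K5D

end FK

end Summit.CriticalPhenomena.PercolationContinuityZ3.Theorems
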